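import Mathlib.LinearAlgebra.Eigenspace.Pi
import Literature.NumberTheory.EllipticCurves.CuspFormTwistGamma1
import HarnessLib

/-!
# The `Γ₁` eigenpacket span over newform packets WITHOUT strong multiplicity one: the degeneracy
# images of the newforms of all levels span `S_k(Γ₁(M))`, and a Hecke/diamond eigenvector lies in the
# span of those carrying its packet (route `CyclotomicUntwist`, child C1 — pure modular-forms layer)

Cell `pub/bsd-wall` (D-0145 line `route-BirchSwinnertonDyer-CyclotomicUntwist`), width seat
`bsd-line-cycu-p4` (gen 12). THEOREMS ONLY (no definition, no named fact, no `sorry`); helper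
`--supports stmt-BirchSwinnertonDyer-27548` (C1 `PSUntwistedLFunctionAtThree`), consumed by the sequel
`CyclotomicUntwistStabilisedTwistOldforms` (the stabilised oldform factorisation of a twisted newform).
BSD is not proved by this file; no crux or child of the route is closed by it.

The tree has strong multiplicity one across levels on `Γ₀` (`IsNewform0.level_eq_of_heckeEigenvalue_eq_holds`,
whence the single-newform `Γ₀` span `mem_span_degeneracyMap0_of_eigenpacket`), but not on `Γ₁`. This file
proves the `Γ₁` statements that do NOT need it:

* §1 `degeneracyMap1_degeneracyMap1`, `degeneracyMap1_self_one` — `[α_{d₁}] ∘ [α_d] = [α_{d d₁}]` and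
  `[α_1] = id` on `Γ₁`, on `q`-expansions (`cuspCoeff_degeneracyMap1`, Diamond–Shurman §5.7).
* §2 `span_degeneracyMap1_newforms_eq_top` — **the degeneracy images `[α_d] g` of the newforms `g` of
  all levels `M₀`, `M₀ d ∣ M`, span `S_k(Γ₁(M))`** (Diamond–Shurman Thm. 5.8.3, spanning half), by strong
  induction on the level from `old ⊕ new = S_k` (`oldSubspace1_sup_newSubspace1_holds`, Li 1975) and
  `new = span(newforms)` (`span_newforms1_holds`, Diamond–Shurman Thm. 5.8.2).
* §3 `mem_span_degeneracyMap1_of_eigenpacket` — **`Γ₁` EIGENPACKET SPAN, multi-newform form**: a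
  simultaneous eigenvector `x` of the `T_ℓ` (`ℓ ∤ M`) and of the diamond operators lies in the span of
  the `[α_d] g` over the newforms `g` (levels `M₀ ∣ M`) with THAT packet (`a_ℓ(g) = a_ℓ` for `ℓ ∤ M` and
  nebentypus inducing the character of `x`) — by the independence of the joint generalised eigenspaces
  of the commuting family `{T_ℓ} ∪ {⟨u⟩}` (Mathlib); several newforms may carry the packet, all are
  allowed (`heckeT_degeneracyMap1_newform`, `diamondOp_degeneracyMap1_newform` give the packet of
  `[α_d] g`, Diamond–Shurman Prop. 5.6.2).

References: [cite: DiamondShurman2005, Prop. 5.6.2, §5.7, Thm. 5.8.2, Thm. 5.8.3] · [cite: Li1975, Thm. 3].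
-/

noncomputable section

open scoped MatrixGroups

open CongruenceSubgroup UpperHalfPlane Complex Function
open Literature.NumberTheory.EllipticCurves Literature.NumberTheory.EllipticCurves.ModularForms

-- single-conjunct summit: `Summit.BirchSwinnertonDyer.BirchSwinnertonDyer.…` repeats the name by design
set_option linter.dupNamespace false
set_option autoImplicit false

namespace Summit.BirchSwinnertonDyer.BirchSwinnertonDyer.Theorems.Gamma1EigenpacketSpan

/-! ### §1 Degeneracy maps on `Γ₁`: composition and the identity -/

section Degeneracy

variable {k : ℤ}

/-- **`[α_{d₁}]_k ∘ [α_d]_k = [α_{d d₁}]_k`** for the degeneracy maps on `Γ₁` (`M₀ d ∣ M₁`, `M₁ d₁ ∣ M`):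
both sides have `n`-th coefficient `(d d₁)^{k-1} 𝟙_{d d₁ ∣ n} a_{n/(d d₁)}(g)` (Diamond–Shurman §5.7,
`ι_d` on Fourier expansions). [cite: DiamondShurman2005, §5.7 p. 211] -/
theorem degeneracyMap1_degeneracyMap1 {M₀ M₁ M d d₁ : ℕ} [NeZero M₀] [NeZero M₁] [NeZero M] [NeZero d]
    [NeZero d₁] [NeZero (d * d₁)] (hMd : M₀ * d ∣ M₁) (hMd₁ : M₁ * d₁ ∣ M) (g : CuspForm (Gamma1 M₀) k) :
    degeneracyMap1 M₁ M d₁ k (degeneracyMap1 M₀ M₁ d k g) = degeneracyMap1 M₀ M (d * d₁) k g := by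
  have hM₀ : M₀ * (d * d₁) ∣ M :=
    calc M₀ * (d * d₁) = (M₀ * d) * d₁ := by ring
      _ ∣ M₁ * d₁ := mul_dvd_mul_right hMd d₁
      _ ∣ M := hMd₁
  refine eq_of_forall_cuspCoeff_eq_gamma1 fun n ↦ ?_
  rw [cuspCoeff_degeneracyMap1 hMd₁, cuspCoeff_degeneracyMap1 hM₀]
  by_cases hd₁n : d₁ ∣ n
  · rw [if_pos hd₁n, cuspCoeff_degeneracyMap1 hMd]
    by_cases hdn : d ∣ n / d₁
    · have hdd : d * d₁ ∣ n := by
        obtain ⟨q, hq⟩ := hd₁n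
        obtain ⟨r, hr⟩ := hdn
        have hq' : n / d₁ = q := by rw [hq, Nat.mul_div_cancel_left q (NeZero.pos d₁)]
        refine ⟨r, ?_⟩
        rw [hq' ] at hr
        rw [hq, hr]
        ring
      rw [if_pos hdn, if_pos hdd, Nat.div_div_eq_div_mul, mul_comm d₁ d, Nat.cast_mul, mul_zpow]
      ring
    · have hdd : ¬ d * d₁ ∣ n := by
        rintro ⟨r, hr⟩
        apply hdn
        refine ⟨r, ?_⟩
        rw [hr, show d * d₁ * r = d₁ * (d * r) by ring, Nat.mul_div_cancel_left _ (NeZero.pos d₁)]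
      rw [if_neg hdn, if_neg hdd, mul_zero, mul_zero, mul_zero]
  · have hdd : ¬ d * d₁ ∣ n := fun h ↦ hd₁n ((dvd_mul_left d₁ d).trans h)
    rw [if_neg hd₁n, if_neg hdd, mul_zero, mul_zero]

/-- `[α_1]_k : S_k(Γ₁(M)) → S_k(Γ₁(M))` is the identity (`a_n([α_1] g) = a_n(g)`). [folklore] -/
theorem degeneracyMap1_self_one {M : ℕ} [NeZero M] (g : CuspForm (Gamma1 M) k) :
    degeneracyMap1 M M 1 k g = g := by
  refine eq_of_forall_cuspCoeff_eq_gamma1 fun n ↦ ?_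
  rw [cuspCoeff_degeneracyMap1 (by simp : M * 1 ∣ M)]
  simp

end Degeneracy

/-! ### §2 The degeneracy images of the newforms of all levels span `S_k(Γ₁(M))` -/

section Span

variable (k : ℤ)

/-- `S_k(Γ₁(M))` is spanned by the `[α_d]_k g`, `g` a newform of level `M₀`, `M₀ d ∣ M` — the statement
of `span_degeneracyMap1_newforms_eq_top` with the level an explicit natural number, for the strong
induction on the level (Diamond–Shurman Thm. 5.8.3, spanning half: `old = Σ [α_d](lower levels)`, IH,
`[α_{d₁}][α_d] = [α_{d d₁}]`; `new = span(newforms)`, `g = [α_1] g`). [cite: DiamondShurman2005, Thm. 5.8.3 (proof)] -/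
theorem span_degeneracyMap1_newforms_eq_top_aux :
    ∀ (M : ℕ) (hM : M ≠ 0), haveI : NeZero M := ⟨hM⟩;
      Submodule.span ℂ {b : CuspForm (Gamma1 M) k |
        ∃ (M₀ : ℕ) (_ : NeZero M₀) (d : ℕ) (_ : NeZero d) (_ : M₀ * d ∣ M) (g : CuspForm (Gamma1 M₀) k),
          IsNewform1 g ∧ b = degeneracyMap1 M₀ M d k g} = ⊤ := by
  intro M
  induction M using Nat.strong_induction_on with
  | _ M ih =>
  intro hM
  haveI : NeZero M := ⟨hM⟩
  apply top_unique
  rw [← oldSubspace1_sup_newSubspace1_holds M k, sup_le_iff]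
  constructor
  · -- the old subspace: images of the lower levels
    rw [oldSubspace1, iSup_le_iff]
    rintro ⟨⟨M₁, d₁⟩, hM₁, hMd₁⟩
    haveI hM₁0 : NeZero M₁ := ⟨(Nat.pos_of_mem_properDivisors hM₁).ne'⟩
    haveI : NeZero d₁ := ⟨fun h ↦ NeZero.ne M (Nat.eq_zero_of_zero_dvd (by simpa [h] using hMd₁))⟩
    have hlt : M₁ < M := (Nat.mem_properDivisors.mp hM₁).2
    have ih₁ := ih M₁ hlt hM₁0.out
    dsimp only at hMd₁ ih₁ ⊢
    rw [LinearMap.range_eq_map, ← ih₁, Submodule.map_span, Submodule.span_le]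
    rintro _ ⟨b, hb, rfl⟩
    obtain ⟨M₀, _, d, _, hMd, g, hg, rfl⟩ := hb
    haveI : NeZero (d * d₁) := ⟨mul_ne_zero (NeZero.ne d) (NeZero.ne d₁)⟩
    have hM₀ : M₀ * (d * d₁) ∣ M :=
      calc M₀ * (d * d₁) = (M₀ * d) * d₁ := by ring
        _ ∣ M₁ * d₁ := mul_dvd_mul_right hMd d₁
        _ ∣ M := hMd₁
    exact Submodule.subset_span
      ⟨M₀, inferInstance, d * d₁, inferInstance, hM₀, g, hg, degeneracyMap1_degeneracyMap1 hMd hMd₁ g⟩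
  · -- the new subspace: spanned by newforms, `g = [α_1] g`
    rw [← span_newforms1_holds M k, Submodule.span_le]
    intro g hg
    exact Submodule.subset_span
      ⟨M, inferInstance, 1, inferInstance, by simp, g, hg, (degeneracyMap1_self_one g).symm⟩

variable (M : ℕ) [NeZero M]

/-- **The degeneracy images of the newforms span `S_k(Γ₁(M))`** (Diamond–Shurman Thm. 5.8.3,
spanning half): the `[α_d]_k g`, `g` a newform of some level `M₀` with `M₀ d ∣ M`, span `S_k(Γ₁(M))`.
[cite: DiamondShurman2005, Thm. 5.8.3] -/
theorem span_degeneracyMap1_newforms_eq_top :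
    Submodule.span ℂ {b : CuspForm (Gamma1 M) k |
      ∃ (M₀ : ℕ) (_ : NeZero M₀) (d : ℕ) (_ : NeZero d) (_ : M₀ * d ∣ M) (g : CuspForm (Gamma1 M₀) k),
        IsNewform1 g ∧ b = degeneracyMap1 M₀ M d k g} = ⊤ :=
  span_degeneracyMap1_newforms_eq_top_aux k M (NeZero.ne M)

end Span

/-! ### §3 The `Γ₁` eigenpacket span over newform packets (no strong multiplicity one) -/

section Packet

variable {M : ℕ} [NeZero M] {k : ℤ}

/-- `T_p [α_d]_k g = a_p(g) [α_d]_k g` for a newform `g` of level `M₀`, `M₀ d ∣ M`, and a prime `p ∤ M`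
(Diamond–Shurman Prop. 5.6.2 with Thm. 5.8.2: `T_p [α_d] = [α_d] T_p`, `T_p g = a_p(g) g`).
[cite: DiamondShurman2005, Prop. 5.6.2] -/
theorem heckeT_degeneracyMap1_newform {M₀ d : ℕ} [NeZero M₀] [NeZero d] (hMd : M₀ * d ∣ M)
    {g : CuspForm (Gamma1 M₀) k} (hg : IsNewform1 g) {p : ℕ} (hp : p.Prime) (hpM : ¬ p ∣ M) :
    (haveI : NeZero p := ⟨hp.ne_zero⟩; heckeT (Gamma1 M) k p (degeneracyMap1 M₀ M d k g)) =
      cuspCoeff g p • degeneracyMap1 M₀ M d k g := by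
  haveI : NeZero p := ⟨hp.ne_zero⟩
  have hM₀M : M₀ ∣ M := (dvd_mul_right M₀ d).trans hMd
  have hpM₀ : ¬ p ∣ M₀ := fun h ↦ hpM (h.trans hM₀M)
  have hpd : ¬ p ∣ d := fun h ↦ hpM (h.trans ((dvd_mul_left d M₀).trans hMd))
  rw [heckeT_degeneracyMap1_of_not_dvd k hMd hp hpd ⟨fun h ↦ (hpM₀ h).elim, fun h ↦ (hpM h).elim⟩,
    hg.heckeT_apply_eq_cuspCoeff_smul p hp, map_smul]

/-- `⟨u⟩ [α_d]_k g = ε_g(u) [α_d]_k g` for a newform `g` of level `M₀`, `M₀ d ∣ M`, with `ε_g` induced to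
level `M` (Diamond–Shurman Prop. 5.6.2: `⟨u⟩_M [α_d] = [α_d] ⟨u⟩_{M₀}`, and `g ∈ S_k(M₀, ε_g)`).
[cite: DiamondShurman2005, Prop. 5.6.2] -/
theorem diamondOp_degeneracyMap1_newform {M₀ d : ℕ} [NeZero M₀] [NeZero d] (hMd : M₀ * d ∣ M)
    {g : CuspForm (Gamma1 M₀) k} (hg : IsNewform1 g) (u : (ZMod M)ˣ) :
    diamondOp M k (u : ZMod M) (degeneracyMap1 M₀ M d k g) =
      DirichletCharacter.changeLevel ((dvd_mul_right M₀ d).trans hMd) (nebentypus g) (u : ZMod M) •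
        degeneracyMap1 M₀ M d k g := by
  have hM₀M : M₀ ∣ M := (dvd_mul_right M₀ d).trans hMd
  have hD := mem_nebentypusSubspace_iff_diamondOp.mp (IsNewform1.mem_nebentypusSubspace_nebentypus_holds hg)
  rw [diamondOp_degeneracyMap1 M k hMd u.isUnit g]
  obtain ⟨u₁, hu₁⟩ := u.isUnit.map (ZMod.castHom hM₀M (ZMod M₀))
  rw [← hu₁, hD u₁, map_smul, DirichletCharacter.changeLevel_eq_cast_of_dvd _ hM₀M u, hu₁,
    ZMod.castHom_apply]

set_option maxHeartbeats 400000 in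
/-- **The `Γ₁` eigenpacket span over newform packets (no strong multiplicity one).** Let
`x ∈ S_k(Γ₁(M))` lie in `S_k(M, χ)` and satisfy `T_p x = a_p x` for every prime `p ∤ M`. Then `x` lies
in the span of the degeneracy images `[α_d]_k g` of the newforms `g` (levels `M₀`, `M₀ d ∣ M`) WITH THE
SAME PACKET: `a_p(g) = a_p` for all primes `p ∤ M` and `ε_g` induces `χ`. Proof: the `[α_d] g` over ALL
newforms span (`span_degeneracyMap1_newforms_eq_top`); each lies in the joint generalised eigenspace
`V(θ_g)` of the commuting family `{T_p : p ∤ M} ∪ {⟨u⟩}` for the packet of `g`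
(`heckeT_degeneracyMap1_newform`, `diamondOp_degeneracyMap1_newform`); these are independent for distinct
packets (Mathlib `Module.End.independent_iInf_maxGenEigenspace_of_forall_mapsTo`); so
`S_k(Γ₁(M)) = A + B` with `A` the span of the matching `[α_d] g` (`⊆ V(θ_x)`) and `B ⊆ ⨆_{θ ≠ θ_x} V(θ)`,
and writing `x = a + b` gives `b ∈ V(θ_x) ∩ B = 0`. Several newforms may carry the packet of `x`
(the tree has strong multiplicity one across levels only on `Γ₀`); all of them are allowed in the span.
[cite: DiamondShurman2005, Thm. 5.8.3 and Prop. 5.6.2] [cite: Li1975, Thm. 3] -/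
theorem mem_span_degeneracyMap1_of_eigenpacket {x : CuspForm (Gamma1 M) k}
    {χ : DirichletCharacter ℂ M} (hxχ : x ∈ nebentypusSubspace M k χ) {a : ℕ → ℂ}
    (hT : ∀ (p : ℕ) (hp : p.Prime), ¬ p ∣ M →
      (haveI : NeZero p := ⟨hp.ne_zero⟩; heckeT (Gamma1 M) k p x) = a p • x) :
    x ∈ Submodule.span ℂ {b : CuspForm (Gamma1 M) k |
      ∃ (M₀ : ℕ) (_ : NeZero M₀) (d : ℕ) (_ : NeZero d) (hMd : M₀ * d ∣ M) (g : CuspForm (Gamma1 M₀) k),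
        IsNewform1 g ∧ (∀ p : ℕ, p.Prime → ¬ p ∣ M → cuspCoeff g p = a p) ∧
        DirichletCharacter.changeLevel ((dvd_mul_right M₀ d).trans hMd) (nebentypus g) = χ ∧
        b = degeneracyMap1 M₀ M d k g} := by
  classical
  -- the commuting family `{T_p : p ∤ M} ∪ {⟨u⟩}`, indexed by `I`
  let I : Type := {p : ℕ // p.Prime ∧ ¬ p ∣ M} ⊕ (ZMod M)ˣ
  let F : I → Module.End ℂ (CuspForm (Gamma1 M) k) :=
    Sum.elim (fun p ↦ haveI : NeZero p.1 := ⟨p.2.1.ne_zero⟩; heckeT (Gamma1 M) k p.1)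
      (fun u ↦ diamondOp M k (u : ZMod M))
  have hcomm : ∀ i j : I, Commute (F i) (F j) := by
    rintro (⟨p, hp, hpM⟩ | u) (⟨q, hq, hqM⟩ | v)
    · haveI : NeZero p := ⟨hp.ne_zero⟩
      haveI : NeZero q := ⟨hq.ne_zero⟩
      exact heckeT_comm_holds M k p q
    · haveI : NeZero p := ⟨hp.ne_zero⟩
      exact heckeT_diamondOp_comm_holds (N := M) (k := k) p (v : ZMod M)
    · haveI : NeZero q := ⟨hq.ne_zero⟩
      exact (heckeT_diamondOp_comm_holds (N := M) (k := k) q (u : ZMod M)).symm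
    · exact diamondOp_comm M k _ _
  -- its joint generalised eigenspaces `V θ` are independent
  let V : (I → ℂ) → Submodule ℂ (CuspForm (Gamma1 M) k) :=
    fun θ ↦ ⨅ i, (F i).maxGenEigenspace (θ i)
  have hind : iSupIndep V :=
    Module.End.independent_iInf_maxGenEigenspace_of_forall_mapsTo F fun i j φ ↦
      Module.End.mapsTo_maxGenEigenspace_of_comm (hcomm j i) φ
  -- packets
  let pk : (ℕ → ℂ) → DirichletCharacter ℂ M → I → ℂ :=
    fun a' χ' ↦ Sum.elim (fun p ↦ a' p.1) (fun u ↦ χ' (u : ZMod M))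
  have hmemV : ∀ {b : CuspForm (Gamma1 M) k} {a' : ℕ → ℂ} {χ' : DirichletCharacter ℂ M},
      (∀ (p : ℕ) (hp : p.Prime), ¬ p ∣ M →
        (haveI : NeZero p := ⟨hp.ne_zero⟩; heckeT (Gamma1 M) k p b) = a' p • b) →
      (∀ u : (ZMod M)ˣ, diamondOp M k (u : ZMod M) b = χ' (u : ZMod M) • b) →
      b ∈ V (pk a' χ') := by
    intro b a' χ' hT' hD'
    change b ∈ ⨅ i, (F i).maxGenEigenspace (pk a' χ' i)
    rw [Submodule.mem_iInf]
    rintro (⟨p, hp, hpM⟩ | u)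
    · exact Module.End.eigenspace_le_maxGenEigenspace
        (Module.End.mem_eigenspace_iff.mpr (hT' p hp hpM))
    · exact Module.End.eigenspace_le_maxGenEigenspace (Module.End.mem_eigenspace_iff.mpr (hD' u))
  -- `x` lies in the joint eigenspace of its packet
  have hxV : x ∈ V (pk a χ) := hmemV hT (mem_nebentypusSubspace_iff_diamondOp.mp hxχ)
  -- matching and non-matching degeneracy images of newforms
  set Smatch : Set (CuspForm (Gamma1 M) k) := {b |
      ∃ (M₀ : ℕ) (_ : NeZero M₀) (d : ℕ) (_ : NeZero d) (hMd : M₀ * d ∣ M) (g : CuspForm (Gamma1 M₀) k),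
        IsNewform1 g ∧ (∀ p : ℕ, p.Prime → ¬ p ∣ M → cuspCoeff g p = a p) ∧
        DirichletCharacter.changeLevel ((dvd_mul_right M₀ d).trans hMd) (nebentypus g) = χ ∧
        b = degeneracyMap1 M₀ M d k g} with hSmatch
  set Sother : Set (CuspForm (Gamma1 M) k) := {b |
      ∃ (M₀ : ℕ) (_ : NeZero M₀) (d : ℕ) (_ : NeZero d) (hMd : M₀ * d ∣ M) (g : CuspForm (Gamma1 M₀) k),
        IsNewform1 g ∧ ¬ ((∀ p : ℕ, p.Prime → ¬ p ∣ M → cuspCoeff g p = a p) ∧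
          DirichletCharacter.changeLevel ((dvd_mul_right M₀ d).trans hMd) (nebentypus g) = χ) ∧
        b = degeneracyMap1 M₀ M d k g} with hSother
  -- every degeneracy image of a newform is matching or not
  have hsplit : {b : CuspForm (Gamma1 M) k |
      ∃ (M₀ : ℕ) (_ : NeZero M₀) (d : ℕ) (_ : NeZero d) (_ : M₀ * d ∣ M) (g : CuspForm (Gamma1 M₀) k),
        IsNewform1 g ∧ b = degeneracyMap1 M₀ M d k g} ⊆ Smatch ∪ Sother := by
    rintro b ⟨M₀, _, d, _, hMd, g, hg, rfl⟩
    by_cases hm : (∀ p : ℕ, p.Prime → ¬ p ∣ M → cuspCoeff g p = a p) ∧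
        DirichletCharacter.changeLevel ((dvd_mul_right M₀ d).trans hMd) (nebentypus g) = χ
    · exact Or.inl ⟨M₀, inferInstance, d, inferInstance, hMd, g, hg, hm.1, hm.2, rfl⟩
    · exact Or.inr ⟨M₀, inferInstance, d, inferInstance, hMd, g, hg, hm, rfl⟩
  -- the matching images lie in `V (pk a χ)`
  have hA : Submodule.span ℂ Smatch ≤ V (pk a χ) := by
    rw [Submodule.span_le]
    rintro b ⟨M₀, _, d, _, hMd, g, hg, hga, hgχ, rfl⟩
    refine hmemV (fun p hp hpM ↦ ?_) (fun u ↦ ?_)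
    · rw [heckeT_degeneracyMap1_newform hMd hg hp hpM, hga p hp hpM]
    · rw [diamondOp_degeneracyMap1_newform hMd hg u, hgχ]
  -- the non-matching images lie in the other joint eigenspaces
  have hB : Submodule.span ℂ Sother ≤ ⨆ θ ∈ {θ : I → ℂ | θ ≠ pk a χ}, V θ := by
    rw [Submodule.span_le]
    rintro b ⟨M₀, _, d, _, hMd, g, hg, hnot, rfl⟩
    have hθ : pk (cuspCoeff g)
        (DirichletCharacter.changeLevel ((dvd_mul_right M₀ d).trans hMd) (nebentypus g)) ∈
        {θ : I → ℂ | θ ≠ pk a χ} := by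
      intro heq
      apply hnot
      refine ⟨fun p hp hpM ↦ ?_, MulChar.ext fun u ↦ ?_⟩
      · have h := congrFun heq (.inl ⟨p, hp, hpM⟩)
        simpa only [pk, Sum.elim_inl] using h
      · have h := congrFun heq (.inr u)
        simpa only [pk, Sum.elim_inr] using h
    exact (le_biSup V hθ)
      (hmemV (fun p hp hpM ↦ heckeT_degeneracyMap1_newform hMd hg hp hpM)
        (fun u ↦ diamondOp_degeneracyMap1_newform hMd hg u))
  -- decompose `x` along `span Smatch + span Sother = ⊤`
  have hx' : x ∈ Submodule.span ℂ Smatch ⊔ Submodule.span ℂ Sother := by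
    rw [← Submodule.span_union]
    have htop := span_degeneracyMap1_newforms_eq_top k M
    exact Submodule.span_mono hsplit (htop ▸ Submodule.mem_top)
  obtain ⟨y, hy, z, hz, hyz⟩ := Submodule.mem_sup.mp hx'
  have hzV : z ∈ V (pk a χ) := by
    have hz' : z = x - y := by rw [← hyz]; abel
    rw [hz']
    exact sub_mem hxV (hA hy)
  have hdis : Disjoint (V (pk a χ)) (⨆ θ ∈ {θ : I → ℂ | θ ≠ pk a χ}, V θ) :=
    hind.disjoint_biSup (by simp)
  have hz0 : z = 0 := (Submodule.disjoint_def.mp hdis) z hzV (hB hz)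
  rw [← hyz, hz0, add_zero]
  exact hy

end Packet

end Summit.BirchSwinnertonDyer.BirchSwinnertonDyer.Theorems.Gamma1EigenpacketSpan

end
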